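import Summits.QuantumFields.BalabanUV.T4Continuum.Support.NE7EffectiveFormFlatZeroModes
import Summits.QuantumFields.BalabanUV.T4Continuum.Support.NE7PeriodicDeRhamOneForms
import HarnessLib

/-!
# NE7EffectiveFormKernelFlatCharacterisation — THE NULL SPACE OF THE `(j+1)`-STEP EFFECTIVE QUADRATIC FORM AT THE FLAT BACKGROUND IS EXACTLY «LINEARISED GAUGE DIRECTIONS ⊕ CONSTANTS»,
# EVERY LEVEL `j`, EVERY VOLUME `N`, EVERY `U(n)` (`d = 4`): `D²(minAct_{j+1} ∘ chart_1)(0)[v, v] = 0 ⟺ ṽ = dλ + c`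

ROAD-G115 §11 (ii) of the lineage `b2b-balaban-t4-ne7-p1` (CRUX PROVER NE7 #1 = OWNER of BINDER row NE7), generation 116 — CLOSED.  Assembly of
✓ `NE7EffectiveFormCoarseCurlAllLevels.effectiveForm_kernel_closed_flat_allLevels` (kernel ⊆ closed: the sharp lower bound `⟨v, Δ_{j+1} v⟩ ≥ Σ‖curl_1 ṽ‖²`),
✓ `NE7PeriodicDeRhamOneForms.closed_periodic_skew_eq_const_add_dPot` (closed periodic `𝔲(n)`-valued 1-forms are `c + dζ`: discrete de Rham on the torus) and
✓ `NE7EffectiveFormFlatZeroModes.effectiveForm_exact_add_const_eq_zero_flat_allLevels` (the form vanishes on `dλ + c`: explicit curl-free lifts through the iterated linearised average).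
WHAT ([folklore]; 0 def, 0 sorry): **`effectiveForm_kernel_flat_allLevels_iff`** — for `L ≥ 2` there is `ε₀ > 0` such that for `0 < ε ≤ ε₀`, `N ≥ 1`, every `j` and every `v ∈ skewSub 4 n N`:
  `D²(minAct 4 (sfClass 4 L N ε) L N (j+1) ∘ chart_1)(0)[v, v] = 0 ⟺ ∃ λ c, λ : ℤ⁴ → 𝔲(n) N-periodic, c : Fin 4 → 𝔲(n), v = res_N (x, μ ↦ (λ(x) − λ(x + e_μ)) + c_μ)`.
Reading: at the flat background the degenerate directions of Bałaban's variational `Δ_{j+1}` (✓ p827954 ∕ p828048) are PRECISELY the infinitesimal gauge transformations of the coarse datum and the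
constant (torus zero-) modes — no other flat direction of the effective action exists, at any RG step, in any volume.
HONEST FRAMING: flat datum; second-order statement about OUR constrained minimal action (B11 (8) minimisers with `sfClass`); nothing of Bałaban's asserted; NOT NE7 as a spine node; spine 0∕9;
NOT infinite volume, NOT mass gap, NOT BetaPertH, NOT Clay.
-/

set_option autoImplicit false

open scoped BigOperators Matrix Matrix.Norms.L2Operator Topology
open NormedSpace Finset

namespace Summit.QuantumFields.BalabanUV.T4Continuum.NE7EffectiveFormKernelFlatCharacterisation

open Literature.MathematicalPhysics.QuantumFieldTheory.Balaban1983to89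
open B7Prop1Explicit B7Prop2Explicit
open T4AveragingDeficitWall (curl curlAt IsSkewDir)
open AveragingDeficitPeriodicCounting (IsPeriodicDir)
open AveragingDeficitTorusChart (TDir chart chartDir resDir redN redN_boxVec isPeriodicDir_chartDir)
open AveragingDeficitTwoLevelPrep (skewSub)
open BlockAveragePushDirGauge (gaugeDir)
open NE3TangentFlatPush (gaugeDir_flatCfg)
open MinimalActionLevels (perWin)
open MinimalActionSandwich (minAct)
open MinimalActionRate (sfClass)
open MinimalActionWitness (flatCfg)
open NE7FlatAverageCurlCommutation (isSkewDir_chartDir_id)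
open NE7EffectiveFormCoarseCurlAllLevels (effectiveForm_kernel_closed_flat_allLevels)
open NE7EffectiveFormFlatZeroModes (effectiveForm_exact_add_const_eq_zero_flat_allLevels)
open NE7PeriodicDeRhamOneForms (closed_periodic_skew_eq_const_add_dPot curlAt_flatCfg_eq_zero_of_perWin)

noncomputable section

variable {n : Type} [Fintype n] [DecidableEq n]

/-- **`ker Δ^{flat}_{j+1} = {dλ + c}`** (`d = 4`, every `U(n)`, `L ≥ 2`): for `0 < ε ≤ ε₀`, `N ≥ 1`, every level `j` and every `v ∈ skewSub 4 n N`,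
`D²(minAct 4 (sfClass 4 L N ε) L N (j+1) ∘ chart_1)(0)[v, v] = 0` iff `v` is the restriction to the torus bonds of `(λ(x) − λ(x + e_μ)) + c_μ` for an `N`-periodic `𝔲(n)`-valued site field `λ` and a
constant `c : Fin 4 → 𝔲(n)`. [folklore] -/
theorem effectiveForm_kernel_flat_allLevels_iff [Nonempty n] {L : ℕ} [NeZero L] (hL : 2 ≤ L) :
    ∃ ε₀ : ℝ, 0 < ε₀ ∧ ∀ ε : ℝ, 0 < ε → ε ≤ ε₀ → ∀ (N : ℕ) [NeZero N], 1 ≤ N → ∀ (j : ℕ) (v : ↥(skewSub 4 n N)),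
      fderiv ℝ (fderiv ℝ (fun y : ↥(skewSub 4 n N) => minAct 4 (sfClass 4 L N ε) L N (j + 1)
          (chart (ContinuousLinearMap.id ℝ (Matrix n n ℂ)) N (flatCfg : Site 4 → Fin 4 → (Matrix n n ℂ)ˣ) (y : TDir 4 n N)))) 0 v v = 0 ↔
      ∃ (lam : Site 4 → Matrix n n ℂ) (c : Fin 4 → Matrix n n ℂ),
        (∀ (x : Site 4) (i : Fin 4), lam (x + (N : ℤ) • e i) = lam x) ∧ (∀ x : Site 4, lam x ∈ skewAdjoint (Matrix n n ℂ)) ∧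
        (∀ μ : Fin 4, c μ ∈ skewAdjoint (Matrix n n ℂ)) ∧
        (v : TDir 4 n N) = resDir N (fun x μ => gaugeDir (flatCfg : Site 4 → Fin 4 → (Matrix n n ℂ)ˣ) lam x μ + c μ) := by
  obtain ⟨ε₁, hε₁, H₁⟩ := effectiveForm_kernel_closed_flat_allLevels (n := n) hL
  obtain ⟨ε₂, hε₂, H₂⟩ := effectiveForm_exact_add_const_eq_zero_flat_allLevels (n := n) hL
  refine ⟨min ε₁ ε₂, lt_min hε₁ hε₂, fun ε hε hεle N _ hN j v => ⟨fun hv0 => ?_, fun hv => ?_⟩⟩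
  · -- kernel ⊆ closed, then de Rham on the torus
    have hclosed := H₁ ε hε (hεle.trans (min_le_left _ _)) N hN j v hv0
    set vt : Site 4 → Fin 4 → Matrix n n ℂ := chartDir (ContinuousLinearMap.id ℝ (Matrix n n ℂ)) N (v : TDir 4 n N) with hvt
    have hvtP : IsPeriodicDir vt (N : ℤ) := isPeriodicDir_chartDir _ _ _
    have hvtS : IsSkewDir vt := isSkewDir_chartDir_id v.2
    have hcl : ∀ (z : Site 4) (μ ν : Fin 4), curlAt (flatCfg : Site 4 → Fin 4 → (Matrix n n ℂ)ˣ) vt z μ ν = 0 :=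
      curlAt_flatCfg_eq_zero_of_perWin hvtP hclosed
    obtain ⟨c, ζ, hcS, hζS, hζP, hYe⟩ := closed_periodic_skew_eq_const_add_dPot hN vt hvtP hvtS hcl
    refine ⟨fun x => -ζ x, c, fun x i => by simp only [hζP], fun x => (skewAdjoint (Matrix n n ℂ)).neg_mem (hζS x), hcS, ?_⟩
    funext r κ
    have h1 : (v : TDir 4 n N) r κ = vt (boxVec N r) κ := by
      simp only [hvt, chartDir, ContinuousLinearMap.coe_id', id, redN_boxVec]
    rw [h1, hYe, resDir, gaugeDir_flatCfg]
    abel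
  · obtain ⟨lam, c, hlamP, hlamS, hcS, hveq⟩ := hv
    exact H₂ ε hε (hεle.trans (min_le_right _ _)) N hN j lam c hlamP hlamS hcS v hveq

end

end Summit.QuantumFields.BalabanUV.T4Continuum.NE7EffectiveFormKernelFlatCharacterisation
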